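import Summits.QuantumFields.YangMills.Theorems.SwapVirialDeficitSectorLaplaceTipOrigZLayer
import Summits.QuantumFields.YangMills.Theorems.SwapVirialDeficitSectorLaplaceTipParams
import Summits.QuantumFields.YangMills.Theorems.SwapVirialDeficitSectorLaplaceTipLeaderPairSplit
import Summits.QuantumFields.YangMills.Theorems.SwapVirialDeficitSectorLaplaceTipCoreRegionsPrelims
import Summits.QuantumFields.YangMills.Theorems.SwapVirialDeficitQuantitativeLaplacePlaneGaussian
import HarnessLib

/-!
# ★★★ `leaderLayer_ORIG` — THE REGION SOCKET OF THE SMALL-LEADER REGION ORIG (w2 g61's aligned-rotation assembly of (hCore); LEAD's third of the leader layer)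
# (cell ym-idea-1, skeleton ➎ v14∕v15-pre = one prop `hLLm`, `stub_core_tip`; chain: THIS + `leaderLayer_PX/PY` (w2) → ✓`leaderLayer_aligned` → `hLLm` →
# ✓`hubIntegral_hubAt_core_ceiling_of_leaderLayer_meas` → g49's frozen binder → ✓`stub_core_tip_of_core`; LEAD seat ym-line-sfw-p2 g100, free-hands support of
# ⟨stmt-QuantumFields-24197⟩ `SwapVirialDeficit.SwapGluedStiffness`)

ORIG `= {|x|², |y|² ≤ (1+δt²)⁻¹}`.  Per leader pair ✓`tipOrig_zLayer_le` (F4-ORIG + `z`-layer); then the leader-pair split ✓`setLIntegral_leaderPair_le_base` (g49) with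
`G(p) = ofReal(w₀(p)/√det A₀(gnoBase p)·e^{3/2}G_b·Z_c)`, two plane Gaussians ✓`lintegral_exp_neg_mul_sq_fin_two` (`(π/(βs²))²`), the Profile on the ORIG disc
✓`profile_ge_of_ORIG` (`1 ≤ 3·Profile·s⁴` — the `s⁴` cancels the Gaussians' `s⁻⁴`: the coefficient is `δt`-FREE), the tail by ✓`lintegral_gnomonicWeight` twice; constants:
`Z_c/β² ≤ 2C₃·(14400L⁶)^{7/2}/b^{7/2}` (`rpow_seven_halves`), parameters and rate floors from ✓`tipT1_params` (`QT = 10⁶²`, `pT = 98`, `DR = 25·10¹³`, `dR = 18`).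
★★★ `leaderLayer_ORIG` — the region socket for `S = ORIG` VERBATIM as consumed by ✓`leaderLayer_aligned`.

HONEST LABEL: ORIG is one of THREE regions; `leaderLayer_PX/PY` (w2 g61) OPEN ⟹ `hLLm`, (hCore), `stub_core_tip`, ⟨24197⟩ ∕ ⟨24194⟩ OPEN; own crux ⟨22884⟩
`LargeFieldMassRefinementTail` OPEN (blocked-on ⟨19935⟩); the Yang–Mills mass gap is NOT proved; no summit is proved by a line.  THEOREMS ONLY (0 `def`, 0 `sorry`, no instance,
no notation), standard axioms.  `--supports stmt-QuantumFields-24197`.  References: [cite: Luscher1983, §2]; [folklore].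
-/

set_option autoImplicit false
set_option synthInstance.maxSize 1024

noncomputable section

open MeasureTheory Quaternion Set Module
open scoped Quaternion BigOperators ENNReal InnerProductSpace
open Literature.MathematicalPhysics.QuantumLattice
open Literature.MathematicalPhysics.QuantumFieldTheory hiding SU2

namespace Summit.QuantumFields.YangMills.Theorems.SwapVirialDeficit.SectorLaplace

open Summit.QuantumFields.YangMills.Theorems.FemtoTransferGap
open Summit.QuantumFields.YangMills.Theorems.FemtoTransferGap.TT
open Summit.QuantumFields.YangMills.Theorems.VirialFluxGap.RingDeficit
open Summit.QuantumFields.YangMills.Theorems.SwapVirialDeficit.SwapRing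
open Summit.QuantumFields.YangMills.Theorems.SwapVirialDeficit.BlowUpRing
open Summit.QuantumFields.YangMills.Theorems.SwapVirialDeficit.Gnomonic (piWeight piWeight_pos piWeight_le_one gnomonicWeight gnomonicWeight_pos gnomonicWeight_le_one normSq3)
open Summit.QuantumFields.YangMills.Theorems.SwapVirialDeficit.SigmaBall (normSq3_eq)
open Summit.QuantumFields.YangMills.Theorems.QuantitativeLaplace (lintegral_exp_neg_mul_sq_fin_two)

variable {L : ℕ} [NeZero L]

/-! ## §1 Scalar helpers -/

omit [NeZero L] in
/-- `x^{7/2} = x³·√x` for `0 ≤ x`. [folklore] -/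
theorem rpow_seven_halves {x : ℝ} (hx : 0 ≤ x) : x ^ ((7 : ℝ) / 2) = x ^ 3 * Real.sqrt x := by
  rw [show ((7 : ℝ) / 2) = (3 : ℝ) + 1 / 2 by norm_num, Real.rpow_add' hx (by norm_num), show (3 : ℝ) = ((3 : ℕ) : ℝ) by norm_num,
    Real.rpow_natCast, Real.sqrt_eq_rpow]

omit [NeZero L] in
/-- The `z`-and-Gaussian coefficient in the binder's currency: for `0 < b`, `1 ≤ Lr`, `C ≥ 0`,
`(2C/((1+β)√(1+β)))/β² ≤ (2C·14400³·120/((2π)³√(2π)))·Lr²¹·(2π/b)^{7/2}` with `β = b/(14400Lr⁶)`. [folklore] -/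
theorem zc_div_beta_sq_le {b Lr C : ℝ} (hb : 0 < b) (hL : 1 ≤ Lr) (hC : 0 ≤ C) :
    2 * C / ((1 + b / (14400 * Lr ^ 6)) * Real.sqrt (1 + b / (14400 * Lr ^ 6))) / (b / (14400 * Lr ^ 6)) ^ 2 ≤
      2 * C * (14400 ^ 3 * 120) / ((2 * Real.pi) ^ 3 * Real.sqrt (2 * Real.pi)) * Lr ^ 21 * (2 * Real.pi / b) ^ ((7 : ℝ) / 2) := by
  have hL0 : 0 < Lr := by linarith
  set β : ℝ := b / (14400 * Lr ^ 6) with hβ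
  have hβ0 : 0 < β := by positivity
  have hπ0 : 0 < 2 * Real.pi := by positivity
  -- `(1+β)√(1+β) ≥ β√β`
  have hden : β * Real.sqrt β ≤ (1 + β) * Real.sqrt (1 + β) :=
    mul_le_mul (by linarith) (Real.sqrt_le_sqrt (by linarith)) (Real.sqrt_nonneg _) (by linarith)
  have hsβ : 0 < Real.sqrt β := Real.sqrt_pos.2 hβ0
  have h1 : 2 * C / ((1 + β) * Real.sqrt (1 + β)) / β ^ 2 ≤ 2 * C / (β * Real.sqrt β) / β ^ 2 := by
    gcongr
  refine h1.trans (le_of_eq ?_)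
  -- both sides as explicit functions of `b` and `Lr`
  rw [rpow_seven_halves (by positivity)]
  have hsb : Real.sqrt β = Real.sqrt b / (120 * Lr ^ 3) := by
    rw [hβ, Real.sqrt_div' b (by positivity)]
    congr 1
    rw [show (14400 : ℝ) * Lr ^ 6 = (120 * Lr ^ 3) ^ 2 by ring, Real.sqrt_sq (by positivity)]
  have hs2π : Real.sqrt (2 * Real.pi / b) = Real.sqrt (2 * Real.pi) / Real.sqrt b := Real.sqrt_div' _ hb.le
  have hsb0 : 0 < Real.sqrt b := Real.sqrt_pos.2 hb
  have hs2π0 : 0 < Real.sqrt (2 * Real.pi) := Real.sqrt_pos.2 hπ0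
  rw [hsb, hs2π, hβ]
  field_simp

/-! ## §2 The region socket of ORIG -/

set_option maxHeartbeats 3200000 in
/-- ★★★ **`leaderLayer_ORIG`: THE REGION SOCKET OF THE SMALL-LEADER REGION** `ORIG L δt = {xy | normSq3 xy.1 ≤ (1+δt²)⁻¹ ∧ normSq3 xy.2 ≤ (1+δt²)⁻¹}`,
in the exact shape consumed by ✓`leaderLayer_aligned` (constants `Φ, cΦ = 21, CT, pT = 98, QT = 10⁶², K₁ = 1, k₁ = 0, DR = 25·10¹³, dR = 18`). [cite: Luscher1983, §2] -/
theorem leaderLayer_ORIG :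
    ∃ Φ : ℝ, 0 < Φ ∧ ∃ cΦ : ℕ, ∃ CT : ℝ, ∃ pT : ℕ, ∃ QT : ℝ, 0 < QT ∧ ∃ K₁ : ℝ, 0 < K₁ ∧ ∃ k₁ : ℕ, ∃ DR : ℝ, 1 ≤ DR ∧ ∃ dR : ℕ,
      ∀ (L : ℕ) [NeZero L] (b : ℝ), K₁ * (L : ℝ) ^ k₁ ≤ b → ∀ ε : GnoSign L, GoodSign ε → ∀ δt : ℝ, DR * (L : ℝ) ^ dR ≤ δt →
        ∀ (A0 : GnoCoord L → GnoFol L →ₗ[ℝ] GnoFol L), (∀ η, (A0 η).IsSymmetric) →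
          (∀ η (y : GnoFol L), ⟪A0 η y, y⟫_ℝ = iteratedFDeriv ℝ 2 (fun y' : GnoFol L => gnoDeficit z₀ (fun _ => 1) ((1 : ℝ) : ℍ) ε (η + gnoFolEmb y')) 0 (fun _ => y)) →
          (∀ η (y : GnoFol L), ⟪A0 η y, y⟫_ℝ = iteratedDeriv 2 (fun s : ℝ => gnoDeficit (fun _ => false) (fun _ => 1) ((1 : ℝ) : ℍ) ε (η + s • gnoFolEmb y)) 0) →
          (∀ η (y : GnoFol L), ⟪A0 η y, y⟫_ℝ = iteratedFDeriv ℝ 2 (gnoDeficit z₀ (fun _ => 1) ((1 : ℝ) : ℍ) ε) η (fun _ => gnoFolEmb y)) →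
          (Measurable fun q : GnoCoord L × GnoFol L => ⟪A0 q.1 q.2, q.2⟫_ℝ) →
          ∫⁻ xy in {xy : (Fin 3 → ℝ) × (Fin 3 → ℝ) | normSq3 xy.1 ≤ (1 + δt ^ 2)⁻¹ ∧ normSq3 xy.2 ≤ (1 + δt ^ 2)⁻¹},
              ∫⁻ z : Fin 3 → ℝ, ENNReal.ofReal (gnomonicWeight xy.1 * gnomonicWeight xy.2 * gnomonicWeight z) *
                ∫⁻ F : Fol L → Fin 3 → ℝ,
                  ENNReal.ofReal (Real.exp (-(b * gnoDeficit (fun _ => false) (fun _ => 1) (hubAt δt 1) ε ((xy, (z, F)) : GnoCoord L))) * piWeight F) ≤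
            ENNReal.ofReal (Φ * (L : ℝ) ^ cΦ * (2 * Real.pi / b) ^ ((7 : ℝ) / 2) *
                (2 * Real.pi / ((1 - 1 / (2 * (finrank ℝ (GnoFol L) : ℝ))) * b)) ^ ((finrank ℝ (GnoFol L) : ℝ) / 2)) *
              (∫⁻ p : ℝ × ℝ, ENNReal.ofReal ((1 + δt ^ 2) ^ 2 / (1 + (p.1 ^ 2 / (1 + p.1 ^ 2) + p.2 ^ 2 / (1 + p.2 ^ 2)) * (1 + δt ^ 2)) *
                ((1 + p.1 ^ 2)⁻¹ * (1 + p.2 ^ 2)⁻¹ / Real.sqrt (LinearMap.det (A0 (gnoBase p.1 p.2)))))) +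
            ENNReal.ofReal (Real.exp (CT * (L : ℝ) ^ pT - b / (QT * (L : ℝ) ^ pT))) := by
  -- universal constants
  set C3 : ℝ := ∫ w : EuclideanSpace ℝ (Fin 3), ((1 + ‖w‖ ^ 2) ^ 2)⁻¹ with hC3
  have hC30 : 0 ≤ C3 := by rw [hC3]; exact integral_nonneg fun w => by positivity
  set Φ₀ : ℝ := 3 * Real.pi ^ 2 * Real.exp (3 / 2) * (2 * C3 * (14400 ^ 3 * 120) / ((2 * Real.pi) ^ 3 * Real.sqrt (2 * Real.pi))) + 1 with hΦ₀
  have hΦ₀pos : 0 < Φ₀ := by rw [hΦ₀]; positivity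
  set CT₀ : ℝ := Real.pi ^ 4 * (2 * C3 + Real.pi ^ 2) + 60 with hCT₀
  refine ⟨Φ₀, hΦ₀pos, 21, CT₀, 98, 10 ^ 62, by norm_num, 1, one_pos, 0, 25 * 10 ^ 13, by norm_num, 18, ?_⟩
  intro L _ b hb ε hε δt hδt A0 hA0s hA0yy hA0ray hA0amb _hAm
  -- letters of this `L`
  have hL1 : (1 : ℝ) ≤ (L : ℝ) := by exact_mod_cast NeZero.one_le
  have hL0 : (0 : ℝ) < (L : ℝ) := by linarith
  have hb1 : 1 ≤ b := by simpa using hb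
  have hb0 : 0 < b := by linarith
  obtain ⟨sT, κf, ω, hsT, hs2, hκf0, hκf, hκwin, hω0, hω1, hωwin, hθω, -, hrate, hκR, hδwin⟩ := tipT1_params L
  obtain ⟨hwinδ, hsω⟩ := hδwin δt hδt
  have hδt1 : 1 ≤ δt := le_trans (by have := one_le_pow₀ (n := 18) hL1; nlinarith) hδt
  have hδt0 : 0 < δt := by linarith
  set s2 : ℝ := (1 + δt ^ 2)⁻¹ with hs2def
  have hs20 : 0 < s2 := by positivity
  set β : ℝ := b / (14400 * (L : ℝ) ^ 6) with hβ
  have hβ0 : 0 < β := by positivity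
  set Zc : ℝ := 2 * C3 / ((1 + β) * Real.sqrt (1 + β)) with hZc
  have hZc0 : 0 ≤ Zc := by positivity
  have hZc2 : Zc ≤ 2 * C3 := by
    rw [hZc]
    refine div_le_self (by positivity) ?_
    have h1 : 1 ≤ 1 + β := by linarith
    have h2 : 1 ≤ Real.sqrt (1 + β) := Real.one_le_sqrt.2 h1
    nlinarith
  set Gb : ℝ := (2 * Real.pi / ((1 - 1 / (2 * (finrank ℝ (GnoFol L) : ℝ))) * b)) ^ ((finrank ℝ (GnoFol L) : ℝ) / 2) with hGb
  have hGb0 : 0 ≤ Gb := by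
    rw [hGb]
    have hd : (2 : ℝ) ≤ (finrank ℝ (GnoFol L) : ℝ) := by
      rw [finrank_gnoFol_real (L := L)]
      have hc1 : (1 : ℝ) ≤ (Fintype.card (Fol L) : ℝ) := by exact_mod_cast one_le_card_fol (L := L)
      linarith
    have h1 : 0 ≤ 1 - 1 / (2 * (finrank ℝ (GnoFol L) : ℝ)) := by
      rw [sub_nonneg, div_le_one (by positivity)]; linarith
    exact Real.rpow_nonneg (by positivity) _
  set IW : ℝ := ∫ w : GnoFol L, piWeight (gnoFolBlocks w) with hIW
  have hIW0 : 0 ≤ IW := by rw [hIW]; exact integral_nonneg fun w => (piWeight_pos _).le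
  have hIWle : IW ≤ Real.exp (60 * (L : ℝ) ^ 4) := integral_piWeight_gnoFolBlocks_le_exp (L := L)
  set κR : ℝ := (2304 * (L : ℝ) ^ 6 * (Fintype.card (Fol L) : ℝ))⁻¹ *
      (3 * ((2304 * (L : ℝ) ^ 6 * (Fintype.card (Fol L) : ℝ))⁻¹ / 2) / (2 * (finrank ℝ (GnoFol L) : ℝ) * (2484000 * (L : ℝ) ^ 4))) ^ 2 / 4 with hκRdef
  set rate : ℝ := min (sT ^ 2) (κf / (300 * (L : ℝ) ^ 4)) / (3600 * (L : ℝ) ^ 6) with hratedef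
  set T : ℝ := Real.exp (-(b * κR)) * IW * Zc + Real.exp (-(b * rate)) * Real.exp (60 * (L : ℝ) ^ 4) * Real.pi ^ 2 with hT
  have hT0 : 0 ≤ T := by positivity
  -- the Gaussian letters and the base function
  set h : (Fin 2 → ℝ) → ℝ≥0∞ := fun u => ENNReal.ofReal (Real.exp (-(β * s2 * (u 0 ^ 2 + u 1 ^ 2)))) with hh
  have hhm : Measurable h := by rw [hh]; exact ENNReal.measurable_ofReal.comp (by fun_prop)
  have hhint : ∫⁻ u, h u = ENNReal.ofReal (Real.pi / (β * s2)) := by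
    rw [hh]; exact lintegral_exp_neg_mul_sq_fin_two (mul_pos hβ0 hs20)
  set G : ℝ × ℝ → ℝ≥0∞ := fun p => ENNReal.ofReal ((1 + p.1 ^ 2)⁻¹ * (1 + p.2 ^ 2)⁻¹ / Real.sqrt (LinearMap.det (A0 (gnoBase p.1 p.2))) *
      (Real.exp (3 / 2) * Gb * Zc)) with hG
  set P : Set (ℝ × ℝ) := {p | p.1 ^ 2 ≤ s2 ∧ p.2 ^ 2 ≤ s2} with hP
  have hPm : MeasurableSet P := by
    rw [hP]
    exact (measurableSet_le (f := fun p : ℝ × ℝ => p.1 ^ 2) (g := fun _ => s2) (by fun_prop) (by fun_prop)).inter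
      (measurableSet_le (f := fun p : ℝ × ℝ => p.2 ^ 2) (g := fun _ => s2) (by fun_prop) (by fun_prop))
  set ORIG : Set ((Fin 3 → ℝ) × (Fin 3 → ℝ)) := {xy | normSq3 xy.1 ≤ (1 + δt ^ 2)⁻¹ ∧ normSq3 xy.2 ≤ (1 + δt ^ 2)⁻¹} with hORIG
  have hORIGm : MeasurableSet ORIG := by
    rw [hORIG]; unfold normSq3
    exact (measurableSet_le (f := fun xy : (Fin 3 → ℝ) × (Fin 3 → ℝ) => ∑ j, xy.1 j ^ 2) (g := fun _ => (1 + δt ^ 2)⁻¹) (by fun_prop) (by fun_prop)).inter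
      (measurableSet_le (f := fun xy : (Fin 3 → ℝ) × (Fin 3 → ℝ) => ∑ j, xy.2 j ^ 2) (g := fun _ => (1 + δt ^ 2)⁻¹) (by fun_prop) (by fun_prop))
  -- §A the pointwise `z`-layer bound on ORIG
  have hpt : ∀ xy ∈ ORIG,
      (∫⁻ z : Fin 3 → ℝ, ENNReal.ofReal (gnomonicWeight xy.1 * gnomonicWeight xy.2 * gnomonicWeight z) *
        ∫⁻ F : Fol L → Fin 3 → ℝ, ENNReal.ofReal (Real.exp (-(b * gnoDeficit (fun _ => false) (fun _ => 1) (hubAt δt 1) ε ((xy, (z, F)) : GnoCoord L))) * piWeight F)) ≤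
      G (xy.1 0, xy.2 0) * (h (fun i : Fin 2 => xy.1 i.succ) * h (fun i : Fin 2 => xy.2 i.succ)) +
        ENNReal.ofReal (gnomonicWeight xy.1 * gnomonicWeight xy.2 * T) := by
    rintro ⟨x, y⟩ hxy
    rw [hORIG, Set.mem_setOf_eq] at hxy
    obtain ⟨hx, hy⟩ := hxy
    rw [normSq3_eq] at hx hy
    have hz := tipOrig_zLayer_le (L := L) hε hδt1 hwinδ hA0s hA0yy hA0ray hA0amb x y hsT hκf0 hs2 hκf hκwin hx hy hω0 hω1 hωwin hsω hθω hb0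
    have eh1 : h (fun i : Fin 2 => x i.succ) = ENNReal.ofReal (Real.exp (-(b / (14400 * (L : ℝ) ^ 6) * (1 + δt ^ 2)⁻¹ * ((x 1) ^ 2 + (x 2) ^ 2)))) := by
      simp only [hh, hβ, hs2def, Fin.succ_zero_eq_one, Fin.succ_one_eq_two]
    have eh2 : h (fun i : Fin 2 => y i.succ) = ENNReal.ofReal (Real.exp (-(b / (14400 * (L : ℝ) ^ 6) * (1 + δt ^ 2)⁻¹ * ((y 1) ^ 2 + (y 2) ^ 2)))) := by
      simp only [hh, hβ, hs2def, Fin.succ_zero_eq_one, Fin.succ_one_eq_two]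
    rw [eh1, eh2]
    exact hz
  -- §B integrate over ORIG: split main + tail
  have htailm : Measurable fun xy : (Fin 3 → ℝ) × (Fin 3 → ℝ) => ENNReal.ofReal (gnomonicWeight xy.1 * gnomonicWeight xy.2 * T) := by
    unfold gnomonicWeight normSq3; exact ENNReal.measurable_ofReal.comp (by fun_prop)
  have hsplit : ∫⁻ xy in ORIG, (G (xy.1 0, xy.2 0) * (h (fun i : Fin 2 => xy.1 i.succ) * h (fun i : Fin 2 => xy.2 i.succ)) +
        ENNReal.ofReal (gnomonicWeight xy.1 * gnomonicWeight xy.2 * T)) =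
      (∫⁻ xy in ORIG, G (xy.1 0, xy.2 0) * (h (fun i : Fin 2 => xy.1 i.succ) * h (fun i : Fin 2 => xy.2 i.succ))) +
        ∫⁻ xy in ORIG, ENNReal.ofReal (gnomonicWeight xy.1 * gnomonicWeight xy.2 * T) :=
    lintegral_add_right _ htailm
  -- §B1 main part: leader-pair split, plane Gaussians, Profile on the disc
  have hsub : ORIG ⊆ {xy : (Fin 3 → ℝ) × (Fin 3 → ℝ) | (xy.1 0, xy.2 0) ∈ P ∧ xy ∈ ORIG} := by
    rintro ⟨x, y⟩ hxy
    have hxy' := hxy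
    rw [hORIG, Set.mem_setOf_eq, normSq3_eq, normSq3_eq] at hxy'
    refine ⟨?_, hxy⟩
    rw [hP, Set.mem_setOf_eq]
    exact ⟨by nlinarith [sq_nonneg (x 1), sq_nonneg (x 2), hxy'.1], by nlinarith [sq_nonneg (y 1), sq_nonneg (y 2), hxy'.2]⟩
  have hGle : ∀ p ∈ P, G p ≤ ENNReal.ofReal ((1 + δt ^ 2) ^ 2 / (1 + (p.1 ^ 2 / (1 + p.1 ^ 2) + p.2 ^ 2 / (1 + p.2 ^ 2)) * (1 + δt ^ 2)) *
        ((1 + p.1 ^ 2)⁻¹ * (1 + p.2 ^ 2)⁻¹ / Real.sqrt (LinearMap.det (A0 (gnoBase p.1 p.2))))) *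
      ENNReal.ofReal (3 * s2 ^ 2 * (Real.exp (3 / 2) * Gb * Zc)) := by
    intro p hp
    rw [hP, Set.mem_setOf_eq] at hp
    have hprof := profile_ge_of_ORIG (δt := δt) (a := p.1) (b := p.2) (by rw [hs2def] at hp; linarith [hp.1, hp.2])
    have hw0 : 0 ≤ (1 + p.1 ^ 2)⁻¹ * (1 + p.2 ^ 2)⁻¹ / Real.sqrt (LinearMap.det (A0 (gnoBase p.1 p.2))) := by
      have := Real.sqrt_nonneg (LinearMap.det (A0 (gnoBase p.1 p.2))); positivity
    rw [hG, ← ENNReal.ofReal_mul (by positivity)]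
    apply ENNReal.ofReal_le_ofReal
    -- `1 ≤ Profile · 3 s2²`
    have hone : 1 ≤ (1 + δt ^ 2) ^ 2 / (1 + (p.1 ^ 2 / (1 + p.1 ^ 2) + p.2 ^ 2 / (1 + p.2 ^ 2)) * (1 + δt ^ 2)) * (3 * s2 ^ 2) := by
      have e : (1 + δt ^ 2) ^ 2 * s2 ^ 2 = 1 := by rw [hs2def]; field_simp
      nlinarith [hprof, sq_nonneg s2, e]
    calc (1 + p.1 ^ 2)⁻¹ * (1 + p.2 ^ 2)⁻¹ / Real.sqrt (LinearMap.det (A0 (gnoBase p.1 p.2))) * (Real.exp (3 / 2) * Gb * Zc)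
        = ((1 + p.1 ^ 2)⁻¹ * (1 + p.2 ^ 2)⁻¹ / Real.sqrt (LinearMap.det (A0 (gnoBase p.1 p.2))) * (Real.exp (3 / 2) * Gb * Zc)) * 1 := (mul_one _).symm
      _ ≤ ((1 + p.1 ^ 2)⁻¹ * (1 + p.2 ^ 2)⁻¹ / Real.sqrt (LinearMap.det (A0 (gnoBase p.1 p.2))) * (Real.exp (3 / 2) * Gb * Zc)) *
          ((1 + δt ^ 2) ^ 2 / (1 + (p.1 ^ 2 / (1 + p.1 ^ 2) + p.2 ^ 2 / (1 + p.2 ^ 2)) * (1 + δt ^ 2)) * (3 * s2 ^ 2)) :=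
          mul_le_mul_of_nonneg_left hone (by positivity)
      _ = _ := by ring
  have hmain : ∫⁻ xy in ORIG, G (xy.1 0, xy.2 0) * (h (fun i : Fin 2 => xy.1 i.succ) * h (fun i : Fin 2 => xy.2 i.succ)) ≤
      (∫⁻ p : ℝ × ℝ, ENNReal.ofReal ((1 + δt ^ 2) ^ 2 / (1 + (p.1 ^ 2 / (1 + p.1 ^ 2) + p.2 ^ 2 / (1 + p.2 ^ 2)) * (1 + δt ^ 2)) *
        ((1 + p.1 ^ 2)⁻¹ * (1 + p.2 ^ 2)⁻¹ / Real.sqrt (LinearMap.det (A0 (gnoBase p.1 p.2)))))) *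
        ENNReal.ofReal (3 * s2 ^ 2 * (Real.exp (3 / 2) * Gb * Zc) * (Real.pi / (β * s2)) ^ 2) := by
    calc ∫⁻ xy in ORIG, G (xy.1 0, xy.2 0) * (h (fun i : Fin 2 => xy.1 i.succ) * h (fun i : Fin 2 => xy.2 i.succ))
        ≤ ∫⁻ xy in {xy : (Fin 3 → ℝ) × (Fin 3 → ℝ) | (xy.1 0, xy.2 0) ∈ P ∧ xy ∈ ORIG},
            G (xy.1 0, xy.2 0) * (h (fun i : Fin 2 => xy.1 i.succ) * h (fun i : Fin 2 => xy.2 i.succ)) := lintegral_mono_set hsub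
      _ ≤ ∫⁻ p in P, G p * ((∫⁻ u, h u) * (∫⁻ v, h v)) := setLIntegral_leaderPair_le_base G hhm hhm hPm (fun xy => xy ∈ ORIG)
      _ = (∫⁻ p in P, G p) * (ENNReal.ofReal (Real.pi / (β * s2)) * ENNReal.ofReal (Real.pi / (β * s2))) := by
          rw [lintegral_mul_const' _ _ (by rw [hhint]; exact ENNReal.mul_ne_top ENNReal.ofReal_ne_top ENNReal.ofReal_ne_top), hhint]
      _ ≤ (∫⁻ p in P, ENNReal.ofReal ((1 + δt ^ 2) ^ 2 / (1 + (p.1 ^ 2 / (1 + p.1 ^ 2) + p.2 ^ 2 / (1 + p.2 ^ 2)) * (1 + δt ^ 2)) *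
            ((1 + p.1 ^ 2)⁻¹ * (1 + p.2 ^ 2)⁻¹ / Real.sqrt (LinearMap.det (A0 (gnoBase p.1 p.2))))) * ENNReal.ofReal (3 * s2 ^ 2 * (Real.exp (3 / 2) * Gb * Zc))) *
          (ENNReal.ofReal (Real.pi / (β * s2)) * ENNReal.ofReal (Real.pi / (β * s2))) := by
          exact mul_le_mul_of_nonneg_right (setLIntegral_mono' hPm hGle) bot_le
      _ ≤ ((∫⁻ p : ℝ × ℝ, ENNReal.ofReal ((1 + δt ^ 2) ^ 2 / (1 + (p.1 ^ 2 / (1 + p.1 ^ 2) + p.2 ^ 2 / (1 + p.2 ^ 2)) * (1 + δt ^ 2)) *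
            ((1 + p.1 ^ 2)⁻¹ * (1 + p.2 ^ 2)⁻¹ / Real.sqrt (LinearMap.det (A0 (gnoBase p.1 p.2)))))) * ENNReal.ofReal (3 * s2 ^ 2 * (Real.exp (3 / 2) * Gb * Zc))) *
          (ENNReal.ofReal (Real.pi / (β * s2)) * ENNReal.ofReal (Real.pi / (β * s2))) := by
          apply mul_le_mul_of_nonneg_right _ bot_le
          rw [lintegral_mul_const' _ _ ENNReal.ofReal_ne_top]
          exact mul_le_mul_of_nonneg_right (setLIntegral_le_lintegral _ _) bot_le
      _ = _ := by
          rw [← ENNReal.ofReal_mul (by positivity), mul_assoc, ← ENNReal.ofReal_mul (by positivity), ← pow_two]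
  -- §B2 tail part
  have htail : ∫⁻ xy in ORIG, ENNReal.ofReal (gnomonicWeight xy.1 * gnomonicWeight xy.2 * T) ≤ ENNReal.ofReal (Real.pi ^ 2 * Real.pi ^ 2 * T) := by
    have hwm : Measurable fun v : Fin 3 → ℝ => ENNReal.ofReal (gnomonicWeight v) := by
      unfold gnomonicWeight normSq3; exact ENNReal.measurable_ofReal.comp (by fun_prop)
    calc ∫⁻ xy in ORIG, ENNReal.ofReal (gnomonicWeight xy.1 * gnomonicWeight xy.2 * T)
        ≤ ∫⁻ xy : (Fin 3 → ℝ) × (Fin 3 → ℝ), ENNReal.ofReal (gnomonicWeight xy.1 * gnomonicWeight xy.2 * T) := setLIntegral_le_lintegral _ _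
      _ = ∫⁻ xy : (Fin 3 → ℝ) × (Fin 3 → ℝ), ENNReal.ofReal (gnomonicWeight xy.1) * ENNReal.ofReal (gnomonicWeight xy.2) * ENNReal.ofReal T := by
          refine lintegral_congr fun xy => ?_
          rw [ENNReal.ofReal_mul (mul_nonneg (gnomonicWeight_pos _).le (gnomonicWeight_pos _).le), ENNReal.ofReal_mul (gnomonicWeight_pos _).le]
      _ = (∫⁻ xy : (Fin 3 → ℝ) × (Fin 3 → ℝ), ENNReal.ofReal (gnomonicWeight xy.1) * ENNReal.ofReal (gnomonicWeight xy.2)) * ENNReal.ofReal T :=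
          lintegral_mul_const' _ _ ENNReal.ofReal_ne_top
      _ = ENNReal.ofReal (Real.pi ^ 2) * ENNReal.ofReal (Real.pi ^ 2) * ENNReal.ofReal T := by
          rw [MeasureTheory.Measure.volume_eq_prod ((Fin 3 → ℝ)) ((Fin 3 → ℝ)), lintegral_prod_mul hwm.aemeasurable hwm.aemeasurable, Gnomonic.lintegral_gnomonicWeight]
      _ = ENNReal.ofReal (Real.pi ^ 2 * Real.pi ^ 2 * T) := by
          rw [← ENNReal.ofReal_mul (by positivity), ← ENNReal.ofReal_mul (by positivity)]
  -- §C constants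
  -- main coefficient: `3 s2² · e^{3/2} Gb Zc · (π/(β s2))² = 3π² e^{3/2} Gb · Zc/β² ≤ (Φ₀ − 1)·L²¹·(2π/b)^{7/2}·Gb`
  have hZβ := zc_div_beta_sq_le (C := C3) hb0 hL1 hC30
  have hcoef : 3 * s2 ^ 2 * (Real.exp (3 / 2) * Gb * Zc) * (Real.pi / (β * s2)) ^ 2 ≤
      Φ₀ * (L : ℝ) ^ (21 : ℕ) * (2 * Real.pi / b) ^ ((7 : ℝ) / 2) * Gb := by
    have e : 3 * s2 ^ 2 * (Real.exp (3 / 2) * Gb * Zc) * (Real.pi / (β * s2)) ^ 2 =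
        3 * Real.pi ^ 2 * Real.exp (3 / 2) * (Zc / β ^ 2) * Gb := by
      field_simp
    rw [e]
    have hX : 0 ≤ (L : ℝ) ^ (21 : ℕ) * (2 * Real.pi / b) ^ ((7 : ℝ) / 2) := by positivity
    have h1 : Zc / β ^ 2 ≤ 2 * C3 * (14400 ^ 3 * 120) / ((2 * Real.pi) ^ 3 * Real.sqrt (2 * Real.pi)) * (L : ℝ) ^ 21 * (2 * Real.pi / b) ^ ((7 : ℝ) / 2) := by
      rw [hZc, hβ]; exact hZβ
    calc 3 * Real.pi ^ 2 * Real.exp (3 / 2) * (Zc / β ^ 2) * Gb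
        ≤ 3 * Real.pi ^ 2 * Real.exp (3 / 2) * (2 * C3 * (14400 ^ 3 * 120) / ((2 * Real.pi) ^ 3 * Real.sqrt (2 * Real.pi)) * (L : ℝ) ^ 21 *
            (2 * Real.pi / b) ^ ((7 : ℝ) / 2)) * Gb := by gcongr
      _ = (3 * Real.pi ^ 2 * Real.exp (3 / 2) * (2 * C3 * (14400 ^ 3 * 120) / ((2 * Real.pi) ^ 3 * Real.sqrt (2 * Real.pi)))) *
            ((L : ℝ) ^ (21 : ℕ) * (2 * Real.pi / b) ^ ((7 : ℝ) / 2)) * Gb := by ring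
      _ ≤ Φ₀ * ((L : ℝ) ^ (21 : ℕ) * (2 * Real.pi / b) ^ ((7 : ℝ) / 2)) * Gb := by
          apply mul_le_mul_of_nonneg_right _ hGb0
          apply mul_le_mul_of_nonneg_right _ hX
          rw [hΦ₀]; linarith
      _ = _ := by ring
  -- tail: `π⁴·T ≤ e^{CT₀·L⁹⁸ − b/(10⁶²L⁹⁸)}`
  have htailR : Real.pi ^ 2 * Real.pi ^ 2 * T ≤ Real.exp (CT₀ * (L : ℝ) ^ (98 : ℕ) - b / (10 ^ 62 * (L : ℝ) ^ (98 : ℕ))) := by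
    have hρ : 0 < 1 / (10 ^ 62 * (L : ℝ) ^ 98) := by positivity
    -- both exponentials are below `e^{−b/(10⁶² L⁹⁸)}`
    have hE1 : Real.exp (-(b * κR)) ≤ Real.exp (-(b / (10 ^ 62 * (L : ℝ) ^ 98))) := by
      apply Real.exp_le_exp.2
      have := mul_le_mul_of_nonneg_left hκR hb0.le
      rw [mul_one_div] at this
      linarith
    have hE2 : Real.exp (-(b * rate)) ≤ Real.exp (-(b / (10 ^ 62 * (L : ℝ) ^ 98))) := by
      apply Real.exp_le_exp.2
      have := mul_le_mul_of_nonneg_left hrate hb0.le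
      rw [mul_one_div] at this
      linarith
    have hTle : T ≤ (2 * C3 + Real.pi ^ 2) * Real.exp (60 * (L : ℝ) ^ 4) * Real.exp (-(b / (10 ^ 62 * (L : ℝ) ^ 98))) := by
      rw [hT]
      have h60 : 0 ≤ Real.exp (60 * (L : ℝ) ^ 4) := (Real.exp_pos _).le
      have hA : Real.exp (-(b * κR)) * IW * Zc ≤ Real.exp (-(b / (10 ^ 62 * (L : ℝ) ^ 98))) * Real.exp (60 * (L : ℝ) ^ 4) * (2 * C3) :=
        mul_le_mul (mul_le_mul hE1 hIWle hIW0 (Real.exp_pos _).le) hZc2 hZc0 (by positivity)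
      have hB : Real.exp (-(b * rate)) * Real.exp (60 * (L : ℝ) ^ 4) * Real.pi ^ 2 ≤
          Real.exp (-(b / (10 ^ 62 * (L : ℝ) ^ 98))) * Real.exp (60 * (L : ℝ) ^ 4) * Real.pi ^ 2 := by gcongr
      nlinarith [hA, hB, Real.exp_pos (-(b / (10 ^ 62 * (L : ℝ) ^ 98))), Real.exp_pos (60 * (L : ℝ) ^ 4)]
    have hK : Real.pi ^ 2 * Real.pi ^ 2 * ((2 * C3 + Real.pi ^ 2) * Real.exp (60 * (L : ℝ) ^ 4)) ≤ Real.exp (CT₀ * (L : ℝ) ^ (98 : ℕ)) := by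
      have hu : Real.pi ^ 2 * Real.pi ^ 2 * (2 * C3 + Real.pi ^ 2) ≤ Real.exp (Real.pi ^ 4 * (2 * C3 + Real.pi ^ 2)) := by
        have := Real.add_one_le_exp (Real.pi ^ 4 * (2 * C3 + Real.pi ^ 2))
        nlinarith [Real.pi_pos]
      have hL98 : (L : ℝ) ^ 4 ≤ (L : ℝ) ^ (98 : ℕ) := pow_le_pow_right₀ hL1 (by norm_num)
      have hL98' : (1 : ℝ) ≤ (L : ℝ) ^ (98 : ℕ) := one_le_pow₀ hL1
      calc Real.pi ^ 2 * Real.pi ^ 2 * ((2 * C3 + Real.pi ^ 2) * Real.exp (60 * (L : ℝ) ^ 4))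
          = (Real.pi ^ 2 * Real.pi ^ 2 * (2 * C3 + Real.pi ^ 2)) * Real.exp (60 * (L : ℝ) ^ 4) := by ring
        _ ≤ Real.exp (Real.pi ^ 4 * (2 * C3 + Real.pi ^ 2)) * Real.exp (60 * (L : ℝ) ^ 4) := mul_le_mul_of_nonneg_right hu (Real.exp_pos _).le
        _ = Real.exp (Real.pi ^ 4 * (2 * C3 + Real.pi ^ 2) + 60 * (L : ℝ) ^ 4) := by rw [Real.exp_add]
        _ ≤ Real.exp (CT₀ * (L : ℝ) ^ (98 : ℕ)) := by
            apply Real.exp_le_exp.2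
            rw [hCT₀]
            have h0 : 0 ≤ Real.pi ^ 4 * (2 * C3 + Real.pi ^ 2) := by positivity
            nlinarith
    calc Real.pi ^ 2 * Real.pi ^ 2 * T ≤ Real.pi ^ 2 * Real.pi ^ 2 * ((2 * C3 + Real.pi ^ 2) * Real.exp (60 * (L : ℝ) ^ 4) * Real.exp (-(b / (10 ^ 62 * (L : ℝ) ^ 98)))) := by
          gcongr
      _ = (Real.pi ^ 2 * Real.pi ^ 2 * ((2 * C3 + Real.pi ^ 2) * Real.exp (60 * (L : ℝ) ^ 4))) * Real.exp (-(b / (10 ^ 62 * (L : ℝ) ^ 98))) := by ring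
      _ ≤ Real.exp (CT₀ * (L : ℝ) ^ (98 : ℕ)) * Real.exp (-(b / (10 ^ 62 * (L : ℝ) ^ 98))) := mul_le_mul_of_nonneg_right hK (Real.exp_pos _).le
      _ = _ := by rw [← Real.exp_add]; ring_nf
  -- §D assemble
  calc ∫⁻ xy in ORIG, ∫⁻ z : Fin 3 → ℝ, ENNReal.ofReal (gnomonicWeight xy.1 * gnomonicWeight xy.2 * gnomonicWeight z) *
          ∫⁻ F : Fol L → Fin 3 → ℝ, ENNReal.ofReal (Real.exp (-(b * gnoDeficit (fun _ => false) (fun _ => 1) (hubAt δt 1) ε ((xy, (z, F)) : GnoCoord L))) * piWeight F)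
      ≤ ∫⁻ xy in ORIG, (G (xy.1 0, xy.2 0) * (h (fun i : Fin 2 => xy.1 i.succ) * h (fun i : Fin 2 => xy.2 i.succ)) +
          ENNReal.ofReal (gnomonicWeight xy.1 * gnomonicWeight xy.2 * T)) := setLIntegral_mono' hORIGm hpt
    _ = _ := hsplit
    _ ≤ (∫⁻ p : ℝ × ℝ, ENNReal.ofReal ((1 + δt ^ 2) ^ 2 / (1 + (p.1 ^ 2 / (1 + p.1 ^ 2) + p.2 ^ 2 / (1 + p.2 ^ 2)) * (1 + δt ^ 2)) *
          ((1 + p.1 ^ 2)⁻¹ * (1 + p.2 ^ 2)⁻¹ / Real.sqrt (LinearMap.det (A0 (gnoBase p.1 p.2)))))) *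
          ENNReal.ofReal (3 * s2 ^ 2 * (Real.exp (3 / 2) * Gb * Zc) * (Real.pi / (β * s2)) ^ 2) +
        ENNReal.ofReal (Real.pi ^ 2 * Real.pi ^ 2 * T) := add_le_add hmain htail
    _ ≤ (∫⁻ p : ℝ × ℝ, ENNReal.ofReal ((1 + δt ^ 2) ^ 2 / (1 + (p.1 ^ 2 / (1 + p.1 ^ 2) + p.2 ^ 2 / (1 + p.2 ^ 2)) * (1 + δt ^ 2)) *
          ((1 + p.1 ^ 2)⁻¹ * (1 + p.2 ^ 2)⁻¹ / Real.sqrt (LinearMap.det (A0 (gnoBase p.1 p.2)))))) *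
          ENNReal.ofReal (Φ₀ * (L : ℝ) ^ (21 : ℕ) * (2 * Real.pi / b) ^ ((7 : ℝ) / 2) * Gb) +
        ENNReal.ofReal (Real.exp (CT₀ * (L : ℝ) ^ (98 : ℕ) - b / (10 ^ 62 * (L : ℝ) ^ (98 : ℕ)))) := by
        gcongr
    _ = _ := by rw [mul_comm]

end Summit.QuantumFields.YangMills.Theorems.SwapVirialDeficit.SectorLaplace

end
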